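import Mathlib.Analysis.SpecialFunctions.Log.Deriv
import Mathlib.Analysis.SpecialFunctions.Integrals.Basic
import Mathlib.MeasureTheory.Integral.IntervalIntegral.FundThmCalculus
import Mathlib.Analysis.Calculus.IteratedDeriv.Lemmas
import HarnessLib

/-!
# The bounded scale function of Rohde–Schramm's Lemma 7.2 at `κ = 4`

Topic: Probability / random planar geometry (one-variable calculus input). In the proof of
S. Rohde, O. Schramm, *Basic properties of SLE*, Ann. of Math. 161 (2005), Lemma 7.2 for `κ = 4`
(p. 909), the increasing functional `Q(t) = log gₜ'(x) - log(gₜ(x) - gₜ(y))` is controlled by a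
local martingale `Q(t) - G(r_t)` where `G` solves `s(1+s)² G'' + s(1+s) G' = 1` and
`sup G < ∞` (the printed `G` involves the dilogarithm). In the variable `z = 1 + 1/s = X/(X - Y)`
(Lawler's ratio of the two real flows, `z > 1`) the equation reads
`G̃'' + G̃' (2z-1)/(z(z-1)) = 1/(z²(z-1))`, whose solutions have `z(z-1) G̃'(z) = log z + c`. We take
`c = 0`: the **kernel** `k(z) = log z / (z(z-1))` (`kappaFourKernel`) and its primitive
`G̃(z) = ∫₂ᶻ k` (`kappaFourG`), and prove what the martingale argument needs: smoothness on
`(1, ∞)`, the derivative of `k` in closed form (`hasDerivAt_kappaFourKernel`), and the **uniform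
bound `|G̃| ≤ 2` on `(1, ∞)`** (`abs_kappaFourG_le`; `k ≤ 1/z` on `(1, 2]` from `log z ≤ z - 1`, and
`k ≤ 2 log z / z²` on `[2, ∞)` with `∫ log z / z² = -(1 + log z)/z`). No dilogarithm is needed.

## References

* S. Rohde, O. Schramm, *Basic properties of SLE*, Ann. of Math. 161 (2005), Lemma 7.2 (proof,
  p. 909: the function `G` and `sup G < ∞`).
-/

noncomputable section

open Set Filter Topology MeasureTheory
open scoped NNReal

namespace Literature.Probability.RandomPlanarGeometry

/-! ### The kernel `log z / (z (z - 1))` on `(1, ∞)` -/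

/-- The **kernel** `k(z) = log z / (z (z - 1))` (used on `z > 1`). [cite: RohdeSchramm2005, Lemma 7.2] -/
def kappaFourKernel (z : ℝ) : ℝ :=
  Real.log z / (z * (z - 1))

/-- The closed form of `k'`: `((z - 1) - (2z - 1) log z) / (z² (z - 1)²)`. [folklore] -/
def kappaFourKernelDeriv (z : ℝ) : ℝ :=
  ((z - 1) - (2 * z - 1) * Real.log z) / (z ^ 2 * (z - 1) ^ 2)

/-- `k > 0` on `(1, ∞)`. [folklore] -/
theorem kappaFourKernel_pos {z : ℝ} (hz : 1 < z) : 0 < kappaFourKernel z :=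
  div_pos (Real.log_pos hz) (mul_pos (by linarith) (by linarith))

/-- `k ≥ 0` on `(1, ∞)`. [folklore] -/
theorem kappaFourKernel_nonneg {z : ℝ} (hz : 1 < z) : 0 ≤ kappaFourKernel z :=
  (kappaFourKernel_pos hz).le

/-- `k` is smooth on `(1, ∞)`. [folklore] -/
theorem contDiffOn_kappaFourKernel {n : ℕ∞} : ContDiffOn ℝ n kappaFourKernel (Ioi 1) := by
  intro z hz
  have hz' : (1 : ℝ) < z := hz
  have h1 : ContDiffAt ℝ n Real.log z := Real.contDiffAt_log.2 (by linarith)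
  have h2 : ContDiffAt ℝ n (fun z : ℝ ↦ z * (z - 1)) z :=
    contDiffAt_id.mul (contDiffAt_id.sub contDiffAt_const)
  exact (h1.div h2 (mul_ne_zero (by linarith) (by linarith))).contDiffWithinAt

/-- `k` is continuous on `(1, ∞)`. [folklore] -/
theorem continuousOn_kappaFourKernel : ContinuousOn kappaFourKernel (Ioi 1) :=
  (contDiffOn_kappaFourKernel (n := 0)).continuousOn

/-- **`k' = ((z-1) - (2z-1) log z)/(z²(z-1)²)`** on `(1, ∞)` (quotient rule). [folklore] -/
theorem hasDerivAt_kappaFourKernel {z : ℝ} (hz : 1 < z) :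
    HasDerivAt kappaFourKernel (kappaFourKernelDeriv z) z := by
  have hz0 : z ≠ 0 := by linarith
  have hz1 : z - 1 ≠ 0 := by linarith
  have h1 : HasDerivAt Real.log z⁻¹ z := Real.hasDerivAt_log hz0
  have h2 : HasDerivAt (fun z : ℝ ↦ z * (z - 1)) (1 * (z - 1) + z * 1) z :=
    (hasDerivAt_id z).mul ((hasDerivAt_id z).sub_const 1)
  have h := h1.div h2 (mul_ne_zero hz0 hz1)
  refine h.congr_deriv ?_
  simp only [kappaFourKernelDeriv]
  field_simp
  ring

/-- `deriv k` in closed form on `(1, ∞)`. [folklore] -/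
theorem deriv_kappaFourKernel {z : ℝ} (hz : 1 < z) : deriv kappaFourKernel z = kappaFourKernelDeriv z :=
  (hasDerivAt_kappaFourKernel hz).deriv

/-- **The differential equation**: `k' + k (2z-1)/(z(z-1)) = 1/(z²(z-1))` on `(1, ∞)` — i.e. with
`G̃' = k`, `G̃'' + G̃'(2z-1)/(z(z-1)) = 1/(z²(z-1))`, the `κ = 4` equation of Rohde–Schramm's
Lemma 7.2 in the variable `z = 1 + 1/s`. [cite: RohdeSchramm2005, Lemma 7.2] -/
theorem kappaFourKernel_ode {z : ℝ} (hz : 1 < z) :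
    kappaFourKernelDeriv z + kappaFourKernel z * ((2 * z - 1) / (z * (z - 1))) =
      1 / (z ^ 2 * (z - 1)) := by
  have hz0 : z ≠ 0 := by linarith
  have hz1 : z - 1 ≠ 0 := by linarith
  simp only [kappaFourKernelDeriv, kappaFourKernel]
  field_simp
  ring

/-- `k` is integrable on compact subintervals of `(1, ∞)`. [folklore] -/
theorem intervalIntegrable_kappaFourKernel {r s : ℝ} (hr : 1 < r) (hs : 1 < s) :
    IntervalIntegrable kappaFourKernel volume r s :=
  (continuousOn_kappaFourKernel.mono fun u hu ↦ by
    rcases le_total r s with h | h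
    · rw [uIcc_of_le h] at hu; exact lt_of_lt_of_le hr hu.1
    · rw [uIcc_of_ge h] at hu; exact lt_of_lt_of_le hs hu.1).intervalIntegrable

/-- **`k(z) ≤ 1/z ≤ 1` on `(1, ∞)`** (`log z ≤ z - 1`). [folklore] -/
theorem kappaFourKernel_le_one {z : ℝ} (hz : 1 < z) : kappaFourKernel z ≤ 1 := by
  have hz0 : 0 < z := by linarith
  have hlog : Real.log z ≤ z - 1 := Real.log_le_sub_one_of_pos hz0
  have hden : 0 < z * (z - 1) := mul_pos hz0 (by linarith)
  rw [kappaFourKernel, div_le_one hden]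
  nlinarith

/-- **`k(z) ≤ 2 log z / z²` for `z ≥ 2`** (`z - 1 ≥ z/2`). [folklore] -/
theorem kappaFourKernel_le_of_two_le {z : ℝ} (hz : 2 ≤ z) :
    kappaFourKernel z ≤ 2 * Real.log z / z ^ 2 := by
  have hz0 : 0 < z := by linarith
  have hlog : 0 ≤ Real.log z := Real.log_nonneg (by linarith)
  rw [kappaFourKernel, div_le_div_iff₀ (mul_pos hz0 (by linarith)) (by positivity)]
  nlinarith [mul_nonneg hlog hz0.le]

/-! ### The primitive `G̃ = ∫₂ᶻ k` -/

/-- The **scale function** `G̃(z) = ∫₂ᶻ log u/(u(u-1)) du` of the `κ = 4` case of Rohde–Schramm's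
Lemma 7.2, in Lawler's variable `z = X/(X - Y) > 1`. [cite: RohdeSchramm2005, Lemma 7.2] -/
def kappaFourG (z : ℝ) : ℝ :=
  ∫ u in (2 : ℝ)..z, kappaFourKernel u

/-- `G̃(2) = 0`. [folklore] -/
@[simp]
theorem kappaFourG_two : kappaFourG 2 = 0 := by
  simp [kappaFourG]

/-- **`G̃' = k`** on `(1, ∞)`. [folklore] -/
theorem hasDerivAt_kappaFourG {z : ℝ} (hz : 1 < z) : HasDerivAt kappaFourG (kappaFourKernel z) z := by
  have hcont := continuousOn_kappaFourKernel
  refine intervalIntegral.integral_hasDerivAt_right (intervalIntegrable_kappaFourKernel one_lt_two hz) ?_ ?_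
  · exact hcont.stronglyMeasurableAtFilter isOpen_Ioi _ hz
  · exact hcont.continuousAt (isOpen_Ioi.mem_nhds hz)

/-- `deriv G̃ = k` on `(1, ∞)`. [folklore] -/
theorem deriv_kappaFourG {z : ℝ} (hz : 1 < z) : deriv kappaFourG z = kappaFourKernel z :=
  (hasDerivAt_kappaFourG hz).deriv

/-- `G̃` is smooth on `(1, ∞)`. [folklore] -/
theorem contDiffOn_kappaFourG {n : ℕ} : ContDiffOn ℝ (n + 1) kappaFourG (Ioi 1) := by
  rw [contDiffOn_succ_iff_deriv_of_isOpen isOpen_Ioi]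
  refine ⟨fun z hz ↦ (hasDerivAt_kappaFourG hz).differentiableAt.differentiableWithinAt,
    fun h ↦ absurd h (by exact_mod_cast WithTop.coe_ne_top), ?_⟩
  exact contDiffOn_kappaFourKernel.congr fun z hz ↦ deriv_kappaFourG hz

/-- `G̃` is `C²` on `(1, ∞)`. [folklore] -/
theorem contDiffOn_two_kappaFourG : ContDiffOn ℝ 2 kappaFourG (Ioi 1) :=
  contDiffOn_kappaFourG (n := 1)

/-- **`G̃'' = k'`** on `(1, ∞)`. [folklore] -/
theorem iteratedDeriv_two_kappaFourG {z : ℝ} (hz : 1 < z) :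
    iteratedDeriv 2 kappaFourG z = kappaFourKernelDeriv z := by
  rw [iteratedDeriv_succ, iteratedDeriv_one]
  have h : deriv kappaFourG =ᶠ[𝓝 z] kappaFourKernel := by
    filter_upwards [isOpen_Ioi.mem_nhds hz] with w hw
    exact deriv_kappaFourG hw
  rw [h.deriv_eq]
  exact deriv_kappaFourKernel hz

/-- `G̃` is monotone on `(1, ∞)`. [folklore] -/
theorem monotoneOn_kappaFourG : MonotoneOn kappaFourG (Ioi 1) :=
  monotoneOn_of_deriv_nonneg (convex_Ioi 1) contDiffOn_two_kappaFourG.continuousOn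
    (fun z hz ↦ by
      rw [interior_Ioi] at hz
      exact (hasDerivAt_kappaFourG hz).differentiableAt.differentiableWithinAt)
    fun z hz ↦ by
      rw [interior_Ioi] at hz
      rw [deriv_kappaFourG hz]
      exact kappaFourKernel_nonneg hz

/-- **`0 ≤ G̃(z) ≤ 1 + log 2` for `z ≥ 2`**: `G̃(z) = ∫₂ᶻ k ≤ ∫₂ᶻ 2 log u / u² du
= (1 + log 2) - 2(1 + log z)/z`. [cite: RohdeSchramm2005, Lemma 7.2] -/
theorem kappaFourG_le_of_two_le {z : ℝ} (hz : 2 ≤ z) : kappaFourG z ≤ 1 + Real.log 2 := by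
  have hz1 : (1 : ℝ) < z := by linarith
  -- the primitive `F(u) = -2 (1 + log u)/u` of `2 log u / u²`
  have hF : ∀ u ∈ Icc (2 : ℝ) z, HasDerivAt (fun u : ℝ ↦ -2 * (1 + Real.log u) / u)
      (2 * Real.log u / u ^ 2) u := by
    intro u hu
    have hu0 : u ≠ 0 := by linarith [hu.1]
    have h1 : HasDerivAt (fun u : ℝ ↦ -2 * (1 + Real.log u)) (-2 * u⁻¹) u := by
      simpa using ((Real.hasDerivAt_log hu0).const_add 1).const_mul (-2)
    have h := h1.div (hasDerivAt_id' u) hu0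
    refine h.congr_deriv ?_
    field_simp
    ring
  have hcontF' : ContinuousOn (fun u : ℝ ↦ 2 * Real.log u / u ^ 2) (Icc 2 z) := by
    refine ContinuousOn.div (continuousOn_const.mul (Real.continuousOn_log.mono ?_))
      (continuousOn_pow 2) fun u hu ↦ ?_
    · intro u hu
      simp only [mem_compl_iff, mem_singleton_iff]
      linarith [hu.1]
    · have : (0 : ℝ) < u := by linarith [hu.1]
      positivity
  have hint : ∫ u in (2 : ℝ)..z, 2 * Real.log u / u ^ 2 =
      (-2 * (1 + Real.log z) / z) - (-2 * (1 + Real.log 2) / 2) := by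
    refine intervalIntegral.integral_eq_sub_of_hasDerivAt_of_le (f := fun u : ℝ ↦ -2 * (1 + Real.log u) / u)
      hz ?_ (fun u hu ↦ ?_) (hcontF'.intervalIntegrable_of_Icc hz)
    · refine ContinuousOn.div (continuousOn_const.mul (continuousOn_const.add
        (Real.continuousOn_log.mono ?_))) continuousOn_id fun u hu ↦ by linarith [hu.1]
      intro u hu
      simp only [mem_compl_iff, mem_singleton_iff]
      linarith [hu.1]
    · exact hF u ⟨hu.1.le, hu.2.le⟩
  have hmono : kappaFourG z ≤ ∫ u in (2 : ℝ)..z, 2 * Real.log u / u ^ 2 :=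
    intervalIntegral.integral_mono_on hz (intervalIntegrable_kappaFourKernel one_lt_two hz1)
      (hcontF'.intervalIntegrable_of_Icc hz) fun u hu ↦ kappaFourKernel_le_of_two_le hu.1
  refine hmono.trans ?_
  rw [hint]
  have hlogz : 0 ≤ Real.log z := Real.log_nonneg (by linarith)
  have h1 : 0 ≤ 2 * (1 + Real.log z) / z := by positivity
  have h2 : -2 * (1 + Real.log z) / z = -(2 * (1 + Real.log z) / z) := by ring
  rw [h2]
  linarith

/-- `0 ≤ G̃(z)` for `z ≥ 2`. [folklore] -/
theorem kappaFourG_nonneg_of_two_le {z : ℝ} (hz : 2 ≤ z) : 0 ≤ kappaFourG z := by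
  have h := monotoneOn_kappaFourG (show (2 : ℝ) ∈ Ioi 1 by norm_num) (show z ∈ Ioi 1 from by
    simp only [mem_Ioi]; linarith) hz
  rwa [kappaFourG_two] at h

/-- **`-1 ≤ G̃(z) ≤ 0` for `1 < z ≤ 2`** (`0 ≤ k ≤ 1` there). [folklore] -/
theorem kappaFourG_mem_Icc_of_le_two {z : ℝ} (hz : 1 < z) (hz2 : z ≤ 2) :
    kappaFourG z ∈ Icc (-1 : ℝ) 0 := by
  have hI : IntervalIntegrable kappaFourKernel volume z 2 := intervalIntegrable_kappaFourKernel hz one_lt_two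
  have hval : kappaFourG z = -∫ u in z..(2 : ℝ), kappaFourKernel u := by
    rw [kappaFourG, intervalIntegral.integral_symm]
  have hlo : 0 ≤ ∫ u in z..(2 : ℝ), kappaFourKernel u :=
    intervalIntegral.integral_nonneg hz2 fun u hu ↦ kappaFourKernel_nonneg (lt_of_lt_of_le hz hu.1)
  have hhi : ∫ u in z..(2 : ℝ), kappaFourKernel u ≤ ∫ u in z..(2 : ℝ), (1 : ℝ) :=
    intervalIntegral.integral_mono_on hz2 hI (by simp)
      fun u hu ↦ kappaFourKernel_le_one (lt_of_lt_of_le hz hu.1)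
  rw [intervalIntegral.integral_const, smul_eq_mul, mul_one] at hhi
  rw [hval]
  constructor <;> linarith

/-- **The uniform bound `|G̃| ≤ 2` on `(1, ∞)`** ("it is immediate to verify that
`sup {G(x) : x > 0} < ∞`", Rohde–Schramm p. 909; here also the lower bound, the primitive being
based at `z = 2`). [cite: RohdeSchramm2005, Lemma 7.2] -/
theorem abs_kappaFourG_le {z : ℝ} (hz : 1 < z) : |kappaFourG z| ≤ 2 := by
  have hlog2 : Real.log 2 < 1 := by
    have := Real.log_lt_sub_one_of_pos (show (0 : ℝ) < 2 by norm_num) (by norm_num)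
    linarith
  rw [abs_le]
  rcases le_or_gt z 2 with hz2 | hz2
  · have h := kappaFourG_mem_Icc_of_le_two hz hz2
    constructor <;> linarith [h.1, h.2]
  · have h1 := kappaFourG_nonneg_of_two_le hz2.le
    have h2 := kappaFourG_le_of_two_le hz2.le
    constructor <;> linarith

end Literature.Probability.RandomPlanarGeometry
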